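import Summits.AtomisticToContinuum.BoseEinsteinCondensation.Theses.BECInsertionCorrector
import Summits.AtomisticToContinuum.BoseEinsteinCondensation.Theorems.BECInsertionCorrectorCorrectorClosureVolumeBootstrapDilation
import Summits.AtomisticToContinuum.BoseEinsteinCondensation.Theorems.BECInsertionCorrectorCorrectorClosureDensityUniformDichotomyBudget
import Summits.AtomisticToContinuum.BoseEinsteinCondensation.Theorems.BECPhaseQuadratureSumRuleMinimiserRegularity
import Literature.MathematicalPhysics.QuantumManyBody.TorusBoseFockLayer
import HarnessLib

/-!
# Crux `CorrectorClosure` (stmt-AtomisticToContinuum-12058), line `volume-homotopy-sum-rule-domination` —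
# registered stub `stub_volumeBootstrap` (S5): the volume bootstrap (dilute anchor + connectedness)

Supports (does not close) stmt-AtomisticToContinuum-12058, route `BECInsertionCorrector`.

**Statement.** For a smooth-class `v` (repulsive finite range, finite, `x ↦ v(|x|)` of class `C²` with
the edge condition), `N ∈ ℕ` and `L₀ > 0`: IF every exact finite-energy minimiser of the periodic
`N`-body energy at every side `L ≥ L₀` has `n₀ ≤ N/4 ∨ 3N/4 ≤ n₀` (the dichotomy of S4 at this `N`),
THEN every such minimiser at every `L ≥ L₀` has `n₀ ≥ 3N/4` (`stub_volumeBootstrap`, the registered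
signature verbatim). No uniformity in `N` is claimed or used.

**The dilute anchor** (`vb_anchor`). There is `L_A(N, v)` such that every exact minimiser at every side
`L ≥ L_A` has `n₀ ≥ 3N/4`: `N - n₀ = Σ_{k≠0} n_k ≤ (L/2π)² Σ_k |k|² n_k = (L/2π)² ∫|∇Ψ|²`
(`vb_depletion_le`: Parseval `Σ_k n_k = N`, the kinetic identity
`tsum_normSq_waveVector_mul_momentumOccupation`, `|k| ≥ 2π/L` for `k ≠ 0`), and
`∫|∇Ψ|² ≤ E₀(N, L) ≤ 16πR (N/L³) N` for `N ≥ 2`, `L > 4R`, `N/L³ < ρ₁(R)` (`dud_groundStateEnergy_le`,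
Dyson–LSSY), so `N - n₀ ≤ 4RN²/(πL) ≤ N/4` once `πL ≥ 16RN` (`vb_threeQuarters_le_of_budget`);
`E₀(1, L) = 0`; `N = 0` is trivial.

**Proof of the bootstrap (connectedness of `[L₀, ∞)`, no perturbation theory).** `N = 0` is trivial. For
`N ≥ 1` call a side `L'` *good* if every finite-energy minimiser at `L'` has `n₀ ≥ 3N/4`. Besides the
anchor: local constancy `vb_localConstancy` (aux file `…VolumeBootstrapDilation`): around every `L₁ > 0`
there is a radius `r(L₁) > 0` within which minimisers at `L'` and at `L₁` have `n₀` within `N/8` of each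
other; and minimisers exist at every side (`minimiserRegularity_proof`, item 12619). Let `U` (resp. `V`)
be the union of the balls `(L' - r(L'), L' + r(L'))` over the good (resp. not good) sides `L' ≥ L₀`; both
are open, together they cover `[L₀, ∞)`, and `U` meets `[L₀, ∞)` at `max L₀ L_A`. If the given side `L`
were not good, `V` would meet `[L₀, ∞)` too, and `isPreconnected_Ici` would give `L'' ≥ L₀` within
`r(L_a)` of a good `L_a ≥ L₀` and within `r(L_b)` of a bad `L_b ≥ L₀`; with a minimiser `Ψ''` at `L''`, a
finite-energy minimiser `Ψ_a` at `L_a` and the bad minimiser `Ψ_b` at `L_b` (`n₀(Ψ_b) ≤ N/4` by the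
dichotomy): `3N/4 ≤ n₀(Ψ_a) ≤ n₀(Ψ'') + N/8 ≤ n₀(Ψ_b) + N/4 ≤ N/2`, absurd for `N ≥ 1`.

## References

* [LSSY2005] E. H. Lieb, R. Seiringer, J. P. Solovej, J. Yngvason, *The Mathematics of the Bose Gas and
  its Condensation*, Birkhäuser (2005): Thm 2.2 (2.14); App. A (A.6), (A.10), (A.11); Ch. 5 footnote to
  (5.3).
* [ReedSimonIV1978] M. Reed, B. Simon, *Methods of Modern Mathematical Physics IV*, Academic Press (1978),
  §XIII.12.
-/

noncomputable section

open MeasureTheory Filter Matrix Set Metric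
open scoped ENNReal NNReal

namespace Summit.AtomisticToContinuum.BoseEinsteinCondensation.Theorems.CorrectorClosure.VolumeHomotopySumRuleDomination

open Literature.MathematicalPhysics.QuantumManyBody.BoseGas
open Summit.AtomisticToContinuum.BoseEinsteinCondensation.Theses.BECInsertionCorrector

/-! ### The dilute anchor -/

/-- **The depletion is controlled by the kinetic energy**: `N - n₀ ≤ (L/2π)² ∫_{cell^N} |∇Ψ|²`
(`N - n₀ = Σ_{k≠0} n_k`, `∫|∇Ψ|² = Σ_k |k|² n_k`, `|k| ≥ 2π/L` for `k ≠ 0`).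
[cite: LSSY2005, App. A (A.6), (A.10), (A.11)] -/
theorem vb_depletion_le {N : ℕ} {L : ℝ} (hL : 0 < L) (Ψ : PeriodicTrialState N L) :
    (N : ℝ≥0∞) - condensateOccupation N L Ψ.ψ ≤
      ENNReal.ofReal ((L / (2 * Real.pi)) ^ 2) * ∫⁻ X in cellN N L, kineticDensity Ψ.ψ X := by
  rw [natCast_sub_condensateOccupation hL Ψ, ← tsum_normSq_waveVector_mul_momentumOccupation hL Ψ,
    ← ENNReal.tsum_mul_left]
  refine ENNReal.tsum_le_tsum fun k => ?_
  by_cases hk : k = 0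
  · rw [if_pos hk]
    exact zero_le
  · rw [if_neg hk, ← mul_assoc]
    refine le_mul_of_one_le_left' ?_
    rw [← ENNReal.ofReal_mul (sq_nonneg _), ← ENNReal.ofReal_one]
    refine ENNReal.ofReal_le_ofReal ?_
    have h := dud_two_pi_div_le_norm_kvec hL hk
    rw [← SumRuleChainGlue.waveVector_eq_kvec] at h
    have h2 : (2 * Real.pi / L) ^ 2 ≤ ‖waveVector L k‖ ^ 2 := pow_le_pow_left₀ (by positivity) h 2
    calc (1 : ℝ) = (L / (2 * Real.pi)) ^ 2 * (2 * Real.pi / L) ^ 2 := by field_simp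
      _ ≤ (L / (2 * Real.pi)) ^ 2 * ‖waveVector L k‖ ^ 2 := by gcongr

/-- From an energy budget `E(Ψ) ≤ B` with `(L/2π)² B ≤ N/4` to `n₀ ≥ 3N/4`. [folklore] -/
theorem vb_threeQuarters_le_of_budget {N : ℕ} {L : ℝ} (hL : 0 < L) (v : ℝ → ℝ≥0∞)
    (Ψ : PeriodicTrialState N L) {B : ℝ} (hB : periodicEnergy v Ψ ≤ ENNReal.ofReal B)
    (hBL : (L / (2 * Real.pi)) ^ 2 * B ≤ (N : ℝ) / 4) :
    ENNReal.ofReal (3 * (N : ℝ) / 4) ≤ condensateOccupation N L Ψ.ψ := by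
  have h1 : (N : ℝ≥0∞) - condensateOccupation N L Ψ.ψ ≤ ENNReal.ofReal ((N : ℝ) / 4) := by
    calc (N : ℝ≥0∞) - condensateOccupation N L Ψ.ψ
        ≤ ENNReal.ofReal ((L / (2 * Real.pi)) ^ 2) * ∫⁻ X in cellN N L, kineticDensity Ψ.ψ X :=
          vb_depletion_le hL Ψ
      _ ≤ ENNReal.ofReal ((L / (2 * Real.pi)) ^ 2) * periodicEnergy v Ψ :=
          mul_le_mul' le_rfl (lintegral_kineticDensity_le_periodicEnergy v Ψ)
      _ ≤ ENNReal.ofReal ((L / (2 * Real.pi)) ^ 2) * ENNReal.ofReal B := mul_le_mul' le_rfl hB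
      _ = ENNReal.ofReal ((L / (2 * Real.pi)) ^ 2 * B) := (ENNReal.ofReal_mul (sq_nonneg _)).symm
      _ ≤ ENNReal.ofReal ((N : ℝ) / 4) := ENNReal.ofReal_le_ofReal hBL
  rw [tsub_le_iff_right] at h1
  refine ENNReal.le_of_add_le_add_right (a := ENNReal.ofReal ((N : ℝ) / 4)) ENNReal.ofReal_ne_top ?_
  rw [← ENNReal.ofReal_add (by positivity) (by positivity),
    show 3 * (N : ℝ) / 4 + (N : ℝ) / 4 = N by ring, ENNReal.ofReal_natCast, add_comm]
  exact h1

/-- **The dilute anchor (fixed `N`).** For a finite-range `v` and `N ∈ ℕ` there is `L_A > 0` such that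
every exact minimiser at every side `L ≥ L_A` has `n₀ ≥ 3N/4`: `N - n₀ ≤ (L/2π)² E₀(N, L)` and
`E₀(N, L) ≤ 16πR (N/L³) N` for `N ≥ 2`, `L > 4R`, `N/L³ < ρ₁(R)` (`dud_groundStateEnergy_le`), so
`N - n₀ ≤ 4RN²/(πL) ≤ N/4` for `πL ≥ 16RN`; `E₀(1, L) = 0`; `N = 0` is trivial.
[cite: LSSY2005, Thm 2.2 (2.14)] -/
theorem vb_anchor {v : ℝ → ℝ≥0∞} (hv : IsRepulsiveFiniteRange v) (N : ℕ) :
    ∃ LA : ℝ, 0 < LA ∧ ∀ L : ℝ, LA ≤ L → ∀ Ψ : PeriodicTrialState N L,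
      periodicEnergy v Ψ = periodicGroundStateEnergy v N L →
      ENNReal.ofReal (3 * (N : ℝ) / 4) ≤ condensateOccupation N L Ψ.ψ := by
  obtain ⟨-, R₀, hR₀⟩ := hv
  rcases Nat.lt_or_ge N 2 with hN | hN
  · refine ⟨1, one_pos, fun L hL Ψ hΨ => ?_⟩
    have hL0 : 0 < L := one_pos.trans_le hL
    interval_cases N
    · simp
    · refine vb_threeQuarters_le_of_budget hL0 v Ψ (B := 0) ?_ (by norm_num)
      rw [hΨ, periodicGroundStateEnergy_one hL0 v]
      exact zero_le
  · set R := max R₀ 1 with hR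
    have hRpos : 0 < R := lt_max_of_lt_right one_pos
    have hvR : ∀ r, R < r → v r = 0 := fun r hr => hR₀ r ((le_max_left _ _).trans_lt hr)
    obtain ⟨ρ₁, hρ₁, hbud⟩ := dud_groundStateEnergy_le hRpos
    refine ⟨max (4 * R + 1) (max (16 * R * N / Real.pi) (N / ρ₁ + 1)), by positivity,
      fun L hL Ψ hΨ => ?_⟩
    have hL1 : 4 * R + 1 ≤ L := (le_max_left _ _).trans hL
    have hL2 : 16 * R * N / Real.pi ≤ L := ((le_max_left _ _).trans (le_max_right _ _)).trans hL
    have hL3 : N / ρ₁ + 1 ≤ L := ((le_max_right _ _).trans (le_max_right _ _)).trans hL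
    have hL0 : 0 < L := by linarith
    have hLone : 1 ≤ L := by linarith
    have hρ : (N : ℝ) / L ^ 3 < ρ₁ := by
      rw [div_lt_iff₀ (by positivity)]
      have h1 : (N : ℝ) / ρ₁ < L := by linarith
      rw [div_lt_iff₀ hρ₁] at h1
      have h2 : L ≤ L ^ 3 := by
        calc L = L ^ 1 := (pow_one L).symm
          _ ≤ L ^ 3 := pow_le_pow_right₀ hLone (by norm_num)
      calc (N : ℝ) < L * ρ₁ := h1
        _ ≤ L ^ 3 * ρ₁ := by gcongr
        _ = ρ₁ * L ^ 3 := mul_comm _ _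
    have hE := hbud N hN L (by linarith) hρ v hvR
    refine vb_threeQuarters_le_of_budget hL0 v Ψ (B := 16 * Real.pi * R * ((N : ℝ) / L ^ 3) * N)
      (by rw [hΨ]; exact hE) ?_
    have hπL : 16 * R * N ≤ Real.pi * L := by
      rw [div_le_iff₀ Real.pi_pos] at hL2
      linarith
    rw [show (L / (2 * Real.pi)) ^ 2 * (16 * Real.pi * R * ((N : ℝ) / L ^ 3) * N) =
        4 * R * (N : ℝ) ^ 2 / (Real.pi * L) by field_simp; ring,
      div_le_div_iff₀ (by positivity) (by norm_num)]
    calc 4 * R * (N : ℝ) ^ 2 * 4 = (N : ℝ) * (16 * R * N) := by ring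
      _ ≤ (N : ℝ) * (Real.pi * L) := by gcongr

/-! ### S5: the volume bootstrap -/

/-- **S5 `stub_volumeBootstrap` — the volume bootstrap (fixed `N`; anchor + local constancy +
connectedness of `[L₀, ∞)`).** For a smooth-class `v`, `N ∈ ℕ` and `L₀ > 0`: if every exact
finite-energy minimiser at every side `L ≥ L₀` has `n₀ ≤ N/4 ∨ 3N/4 ≤ n₀`, then every exact
finite-energy minimiser at every `L ≥ L₀` has `3N/4 ≤ n₀`. Proof: the set of sides `L' ≥ L₀` at which
the minimisers have `n₀ ≥ 3N/4` contains `[L_A, ∞)` (`vb_anchor`) and, like its complement in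
`[L₀, ∞)`, is open by the local constancy of `n₀` up to `N/8` (`vb_localConstancy`, minimisers existing
at every side by `minimiserRegularity_proof`); `[L₀, ∞)` is preconnected (`isPreconnected_Ici`).
[cite: LSSY2005, Thm 2.2 (2.14) and Ch. 5 footnote to (5.3); ReedSimonIV1978, §XIII.12] -/
theorem stub_volumeBootstrap (v : ℝ → ℝ≥0∞) (hv : IsRepulsiveFiniteRange v)
    (hfin : ∀ r, v r ≠ ⊤) (hC2 : ContDiff ℝ 2 (fun x : Space => (v ‖x‖).toReal))
    (hedge : ∃ Cₑ : ℝ, ∀ x : Space,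
      ‖iteratedFDeriv ℝ 2 (fun x : Space => (v ‖x‖).toReal) x‖ ≤ Cₑ * Real.sqrt ((v ‖x‖).toReal))
    (N : ℕ) (L₀ : ℝ) (hL₀ : 0 < L₀)
    (hdich : ∀ L : ℝ, L₀ ≤ L → ∀ Ψ : PeriodicTrialState N L,
      periodicEnergy v Ψ = periodicGroundStateEnergy v N L → periodicEnergy v Ψ ≠ ⊤ →
      condensateOccupation N L Ψ.ψ ≤ ENNReal.ofReal ((N : ℝ) / 4) ∨
        ENNReal.ofReal (3 * (N : ℝ) / 4) ≤ condensateOccupation N L Ψ.ψ) :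
    ∀ L : ℝ, L₀ ≤ L → ∀ Ψ : PeriodicTrialState N L,
      periodicEnergy v Ψ = periodicGroundStateEnergy v N L → periodicEnergy v Ψ ≠ ⊤ →
      ENNReal.ofReal (3 * (N : ℝ) / 4) ≤ condensateOccupation N L Ψ.ψ := by
  intro L hL Ψ hΨ hΨfin
  rcases Nat.eq_zero_or_pos N with rfl | hN
  · simp
  -- `good L'`: every finite-energy minimiser at side `L'` has `n₀ ≥ 3N/4`
  set good : ℝ → Prop := fun L' => ∀ Φ : PeriodicTrialState N L',
    periodicEnergy v Φ = periodicGroundStateEnergy v N L' → periodicEnergy v Φ ≠ ⊤ →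
    ENNReal.ofReal (3 * (N : ℝ) / 4) ≤ condensateOccupation N L' Φ.ψ with hgood
  suffices hG : good L from hG Ψ hΨ hΨfin
  by_contra hbad
  -- (a) the anchor, (b) the radii of local constancy (`ε = 1/8`)
  obtain ⟨LA, hLA0, hA⟩ := vb_anchor hv N
  have hloc : ∀ L₁ : ℝ, 0 < L₁ → ∃ r : ℝ, 0 < r ∧ ∀ L' : ℝ, |L' - L₁| < r →
      ∀ (Ψ' : PeriodicTrialState N L') (Ψ₁ : PeriodicTrialState N L₁),
        periodicEnergy v Ψ' = periodicGroundStateEnergy v N L' →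
        periodicEnergy v Ψ₁ = periodicGroundStateEnergy v N L₁ →
        condensateOccupation N L' Ψ'.ψ ≤
            condensateOccupation N L₁ Ψ₁.ψ + ENNReal.ofReal (1 / 8 * N) ∧
          condensateOccupation N L₁ Ψ₁.ψ ≤
            condensateOccupation N L' Ψ'.ψ + ENNReal.ofReal (1 / 8 * N) :=
    fun L₁ hL₁ => vb_localConstancy hv hfin hC2.continuous N hL₁ (by norm_num)
  choose! r hr0 hr using hloc
  -- the open sets
  set U : Set ℝ := ⋃ L' ∈ {L' : ℝ | L₀ ≤ L' ∧ good L'}, ball L' (r L') with hU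
  set V : Set ℝ := ⋃ L' ∈ {L' : ℝ | L₀ ≤ L' ∧ ¬ good L'}, ball L' (r L') with hV
  have hUo : IsOpen U := isOpen_biUnion fun _ _ => isOpen_ball
  have hVo : IsOpen V := isOpen_biUnion fun _ _ => isOpen_ball
  have hcover : Ici L₀ ⊆ U ∪ V := by
    intro L' hL'
    have hL'0 : 0 < L' := hL₀.trans_le hL'
    by_cases hg : good L'
    · exact Or.inl (mem_biUnion (show L' ∈ {L' : ℝ | L₀ ≤ L' ∧ good L'} from ⟨hL', hg⟩)
        (mem_ball_self (hr0 L' hL'0)))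
    · exact Or.inr (mem_biUnion (show L' ∈ {L' : ℝ | L₀ ≤ L' ∧ ¬ good L'} from ⟨hL', hg⟩)
        (mem_ball_self (hr0 L' hL'0)))
  have hUne : (Ici L₀ ∩ U).Nonempty := by
    refine ⟨max L₀ LA, mem_Ici.2 (le_max_left L₀ LA), mem_biUnion (x := max L₀ LA) ⟨le_max_left _ _, ?_⟩
      (mem_ball_self (hr0 _ (hL₀.trans_le (le_max_left _ _))))⟩
    exact fun Φ hΦ _ => hA _ (le_max_right _ _) Φ hΦ
  have hVne : (Ici L₀ ∩ V).Nonempty :=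
    ⟨L, hL, mem_biUnion (x := L) ⟨hL, hbad⟩ (mem_ball_self (hr0 L (hL₀.trans_le hL)))⟩
  -- connectedness: a side close to a good one and to a bad one
  obtain ⟨L'', hL''₀, hL''U, hL''V⟩ := isPreconnected_Ici U V hUo hVo hcover hUne hVne
  have hL''0 : 0 < L'' := hL₀.trans_le hL''₀
  rw [hU, mem_iUnion₂] at hL''U
  rw [hV, mem_iUnion₂] at hL''V
  obtain ⟨La, ⟨hLa₀, hLa⟩, haL⟩ := hL''U
  obtain ⟨Lb, ⟨hLb₀, hLb⟩, hbL⟩ := hL''V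
  have hLa0 : 0 < La := hL₀.trans_le hLa₀
  have hLb0 : 0 < Lb := hL₀.trans_le hLb₀
  rw [mem_ball, Real.dist_eq] at haL hbL
  -- minimisers at `L''` and `La`; a bad minimiser at `Lb`
  obtain ⟨Ψ'', hΨ'', -, -⟩ := minimiserRegularity_proof v hv hfin hC2 hedge N hN L'' hL''0
  obtain ⟨Ψa, hΨa, hΨafin, -⟩ := minimiserRegularity_proof v hv hfin hC2 hedge N hN La hLa0
  simp only [hgood, not_forall, exists_prop, not_le] at hLb
  obtain ⟨Ψb, hΨb, hΨbfin, hΨblt⟩ := hLb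
  have hΨb_le : condensateOccupation N Lb Ψb.ψ ≤ ENNReal.ofReal ((N : ℝ) / 4) :=
    (hdich Lb hLb₀ Ψb hΨb hΨbfin).resolve_right (not_le.2 hΨblt)
  -- the chain `3N/4 ≤ n₀(Ψa) ≤ n₀(Ψ'') + N/8 ≤ n₀(Ψb) + N/4 ≤ N/2`
  have h1 : ENNReal.ofReal (3 * (N : ℝ) / 4) ≤ condensateOccupation N La Ψa.ψ := hLa Ψa hΨa hΨafin
  have h2 := (hr La hLa0 L'' haL Ψ'' Ψa hΨ'' hΨa).2
  have h3 := (hr Lb hLb0 L'' hbL Ψ'' Ψb hΨ'' hΨb).1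
  have h4 : ENNReal.ofReal (3 * (N : ℝ) / 4) ≤ ENNReal.ofReal ((N : ℝ) / 2) := by
    calc ENNReal.ofReal (3 * (N : ℝ) / 4) ≤ condensateOccupation N La Ψa.ψ := h1
      _ ≤ condensateOccupation N L'' Ψ''.ψ + ENNReal.ofReal (1 / 8 * N) := h2
      _ ≤ condensateOccupation N Lb Ψb.ψ + ENNReal.ofReal (1 / 8 * N) + ENNReal.ofReal (1 / 8 * N) :=
          add_le_add h3 le_rfl
      _ ≤ ENNReal.ofReal ((N : ℝ) / 4) + ENNReal.ofReal (1 / 8 * N) + ENNReal.ofReal (1 / 8 * N) :=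
          add_le_add (add_le_add hΨb_le le_rfl) le_rfl
      _ = ENNReal.ofReal ((N : ℝ) / 2) := by
          rw [← ENNReal.ofReal_add (by positivity) (by positivity),
            ← ENNReal.ofReal_add (by positivity) (by positivity)]
          congr 1
          ring
  rw [ENNReal.ofReal_le_ofReal_iff (by positivity)] at h4
  have hN' : (0 : ℝ) < N := Nat.cast_pos.2 hN
  linarith

end Summit.AtomisticToContinuum.BoseEinsteinCondensation.Theorems.CorrectorClosure.VolumeHomotopySumRuleDomination

end
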